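import Mathlib.Topology.KrullDimension
import Mathlib.NumberTheory.NumberField.Units.DirichletTheorem
import Literature.NumberTheory.Automorphic.AutomorphicRepsGL
import Literature.NumberTheory.GaloisRepresentations.GaloisRep
import HarnessLib

/-!
# Eigenvarieties for `GL_n` over a number field: the interface

Topic: `Literature/NumberTheory/Automorphic` (definition item `defn-Eigenvariety`, wanted by route
`NewtonPatching`, crux `EigenvarietyPackage`, and by the cards `padic-automorphic-induction`,
`even-artin-gl4-door`, `bianchi-artin-points`).

Let `K` be a number field, `n ≥ 1`, `p` a prime and `K^p ⊂ GL_n(𝔸_K^{p,∞})` a tame level with set of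
bad places `S = S(K^p) ⊇ {v ∣ p}`.  Two constructions of an *eigenvariety* for
`G = Res_{K/ℚ} GL_n` of tame level `K^p` are in print:

* Hansen (overconvergent cohomology, Ash–Stevens–Urban): a rigid space `𝒳 = 𝒳_{G,K^p}` with a
  weight map `w : 𝒳 → 𝒲_{K^p}` to the space of continuous characters of
  `T(ℤ_p) = ∏_{v ∣ p} (𝒪_{K_v}ˣ)^n` (trivial on the closure of the global units in `K^p I`) and an
  algebra map `φ_𝒳 : 𝐓(K^p) → 𝒪(𝒳)`; the points of `𝒳(ℚ̄_p)` over `λ` are in canonical bijection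
  with the finite-slope eigenpackets of weight `λ`, `x ↦ φ_{𝒳,x}` (Thm. 1.1.2 = Thm. 4.3.3); every
  point carries a character `δ_x ∈ 𝒯(ℚ̄_p) = Hom_cts(T(ℚ_p), ℚ̄_pˣ)`, `T(ℚ_p) = ∏_{v ∣ p} (K_vˣ)^n`
  (§1.2), and an integer `l(x) = sup − inf` of the degrees in which `φ_x` occurs (§1.1, p. 7);
  **Newton's theorem** (Thm. 1.1.6, Appendix B): every irreducible component of `𝒳` through `x`
  has dimension `≥ dim 𝒲_{K^p} − l(x)`.  [cite: HansenUniversalEigenvarieties2017, Thm. 1.1.2, Thm. 1.1.6, Def. 1.2.1, §1.2, Def. 4.2.1, Thm. 4.3.3]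
* Fu / McDonald (derived Jacquet modules of completed cohomology, after Emerton): for a
  non-Eisenstein maximal ideal `𝔪` of the big Hecke algebra `𝐓^S(K^p)`, rigid spaces
  `ℰ^i(K^p)_𝔪 ⊂ (Spf 𝐓^S(K^p)_𝔪^{red})^{rig} × T̂` whose `ℚ̄_p`-points are pairs `(x, δ)` of a Hecke
  eigensystem `x : 𝐓^S(K^p)_𝔪 → ℚ̄_p` and a character `δ ∈ T̂(ℚ̄_p)`, weight map `κ = ` restriction
  of `δ` to `T(ℤ_p)`; Scholze's determinant gives `ρ : Gal_K → GL_n(𝐓^S(K^p)_𝔪/I)` (`I` nilpotent),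
  unramified outside `S` with `charpoly ρ(Frob_v) = P_v(X)` for `v ∉ S`, hence a semisimple `ρ_x`
  at every point; **McDonald's theorem**: for `K` CM containing an imaginary quadratic field in
  which `p` splits and `𝔪` decomposed generic, `ρ_x|_{Gal_{K_v}}` is trianguline for every `v ∣ p`
  with parameter `(δ + ρ^G_cyc)_v · δ'`, `δ'` algebraic.
  [cite: McDonald2025, Thm. 1, §2.8 (Lemma 32)] [cite: Fu2021DerivedEigenvarieties, §1]
  [cite: Emerton2006, Def. 0.6 and Thm. 0.7] [cite: Scholze2015, Thm. V.4.1 and Cor. V.4.4]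

Neither rigid-analytic geometry, nor overconvergent/completed cohomology, nor `(φ, Γ)`-modules exist
in Mathlib or in this tree, so — exactly as requested by the item ("INTERFACE + separate construction
fact, never existence inside the interface") and in the style of the accepted
`Summit.Langlands.ReciprocityData` / `PstWeilDeligneData` — this file fixes the **type of the datum**
an eigenvariety hands to arithmetic, and the **properties** the two constructions are proved to
enjoy, as separate predicates, so that a route can say which package it posits
(`∃ E : Eigenvariety K n p S, E.HasEigensystemInjective ∧ E.HasGaloisFamily ∧ E.HasNewtonBound ∧
E.ClassicalPointsCuspidal hcpt ι ∧ …` is the crux `EigenvarietyPackage` of route NewtonPatching).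

## Contents

* `PlacesOver K p`, `PAdicWeight K n p L` (`𝒲(L)`: an `n`-tuple, for each `v ∣ p`, of continuous
  characters `𝒪_{K_v}ˣ → Lˣ`), `TorusCharacter K n p L` (`T̂(L) = 𝒯(L)`: same with `K_vˣ`),
  `TorusCharacter.restrict` (`T̂ → 𝒲`, the weight map of Fu–McDonald).  Characters are kept as
  ORDERED TUPLES of characters of `K_vˣ` — the shape in which the parameter of a triangulation is
  stated (Hansen §1.2, McDonald §6).
* `heckeFrobPoly q n t = ∑_{i=0}^{n} (-1)^i q^{i(i-1)/2} t_i X^{n-i}` over any commutative ring (the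
  accepted `heckePolynomial` is the case `ℂ`, `heckeFrobPoly_eq_heckePolynomial`), and
  `FramedGaloisRep.IsHeckeAssociatedAt ρ v t`: **Hansen's Definition 1.2.1** — `ρ` is unramified at
  `v` and `det(X − ρ(Frob_v)) = heckeFrobPoly q_v n t` for GEOMETRIC Frobenii `Frob_v` (Hansen
  normalises uniformisers ↦ geometric Frobenii, §1.4), rendered with the tree's arithmetic
  Frobenius `σ` (`IsArithFrobAt`) as `charpoly ρ(σ⁻¹)`.
* `Eigenvariety K n p S` — the datum: a type of points `Pt` (intended `𝒳(ℚ̄_p)`) with its analytic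
  Zariski topology; the spherical Hecke eigenvalues `heckeEigenvalue x v i = φ_x(T_{v,i}) ∈ ℚ̄_p`
  (`v ∉ S`, `1 ≤ i ≤ n`, `T_{v,0} = 1`); the parameter `param x = δ_x ∈ T̂(ℚ̄_p)` (its restriction
  `weight x ∈ 𝒲(ℚ̄_p)` is the weight); the semisimple Galois representation `galoisRep x = ρ_x`;
  the finite non-empty set `degrees x` of cohomological degrees in which `φ_x` occurs (Hansen's
  `l(x) = max − min` is `defect x`; Fu's `ℰ^i` are the fibres of `degrees`); and the set
  `classical` of classical points (Hansen Def. 3.2.3).  No existence and no theorem is a field.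
* The properties, one predicate each (so that routes see which construction carries which):
  `HasEigensystemInjective` (Hansen Thm. 1.1.2 (ii) / 4.3.3; tautological for Fu's `(x, δ)`),
  `HasGaloisFamily` (Hansen Conj. 1.2.2 (i), a theorem over CM and totally real `K` by Scholze's
  determinants: McDonald Lemma 32), `HasNewtonBoundWith d` / `HasNewtonBound` (Hansen–Newton
  Thm. 1.1.6 with `d = dim 𝒲_{K^p}`; see the Leopoldt note below), `MatchesCuspidal` /
  `ClassicalPointsCuspidal` (classical points carry cuspidal cohomological, hence regular
  algebraic, `π` with matching Hecke polynomials — Hansen Prop. 3.2.1 / Def. 3.2.3, Clozel),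
  `IsCongruentTo` (the `ρ̄`-part `𝒳(ρ̄)`, i.e. localisation at `𝔪 = 𝔪_ρ̄`), and the restriction
  `Eigenvariety.restrict` to a set of points (Hansen's tautology after Thm. 4.2.2: a Zariski-closed
  `𝒴 ⊂ 𝒳` is the eigenvariety of the datum `𝔇_𝒴`) with the pointwise properties it preserves.

## What is deliberately NOT here

* Triangulinity of `ρ_x|_{Gal_{K_v}}` with parameter read off `param x v` (McDonald Thm. 1; Hansen
  Conj. 1.2.2 (iii)): needs `(φ, Γ)`-modules over the Robba ring (definition item
  `defn-TriangulineAt`); once it lands the statement is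
  `∀ x (v : PlacesOver K p), TriangulineAt v ((E.galoisRep x).toLocal v.1) (shift (E.param x v))`.
* The surjectivity half of Hansen Thm. 1.1.2 (every finite-slope eigenpacket is a point) and the
  converse of `ClassicalPointsCuspidal` (every refined cuspidal cohomological `π` of level `K^p`
  is a classical point): both quantify over overconvergent cohomology / the exact level `K^p`,
  which the tree cannot phrase (levels enter here only through `S = S(K^p)`).
* Named existence facts "there is an `Eigenvariety` with property P": over an interface they are
  vacuous (`Pt = ∅` satisfies every property), so none is minted; the meaningful conjunction is
  the route's crux, stated over this vocabulary.
* Leopoldt: `dim 𝒲_{K^p} = n[K:ℚ] − rank_{ℤ_p} \overline{E(K^p)} ≥ n[K:ℚ] − rank 𝒪_Kˣ`, with equality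
  iff Leopoldt's conjecture holds for `(K, p)`.  `HasNewtonBound` uses the unconditional lower
  value `n[K:ℚ] − NumberField.Units.rank K` (so it is implied by Thm. 1.1.6 and is what route
  NewtonPatching's `Numerology` counts); `HasNewtonBoundWith d` keeps `d` free.

## References

* D. Hansen (appendix by J. Newton), *Universal eigenvarieties, trianguline Galois representations,
  and p-adic Langlands functoriality*, J. reine angew. Math. 730 (2017), arXiv:1412.1533.
  [HansenUniversalEigenvarieties2017]
* V. McDonald, *Eigenvarieties over CM fields and trianguline representations*, arXiv:2504.18319
  (2025). [McDonald2025]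
* W. Fu, *A derived construction of eigenvarieties*, arXiv:2110.04797 (2021).
  [Fu2021DerivedEigenvarieties]
* M. Emerton, *On the interpolation of systems of eigenvalues attached to automorphic Hecke
  eigenforms*, Invent. Math. 164 (2006). [Emerton2006]
* P. Scholze, *On torsion in the cohomology of locally symmetric varieties*, Ann. of Math. 182
  (2015). [Scholze2015]
-/

noncomputable section

open scoped NumberField Polynomial
open Field IsDedekindDomain

/-! ### Hansen's "associated" relation between Galois representations and Hecke eigenvalues -/

namespace Literature.NumberTheory.Automorphic

section HeckeFrobPoly

variable {A B : Type*} [CommRing A] [CommRing B]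

/-- The **Hecke–Frobenius polynomial** of `GL_n` at a place with residue cardinality `q` attached
to Hecke eigenvalues `t_0 = 1, t_1, …, t_n` (only these are used), over any commutative ring:
`∑_{i=0}^{n} (-1)^i q^{i(i-1)/2} t_i X^{n-i}`.  For `t_i = φ(T_{v,i})` this is Hansen's
`det(X − ρ(Frob_v))` for a Galois representation associated with `φ` (Definition 1.2.1, written
there as `det(1 − X ρ(Frob_v)) = ∑ (-1)^i Nv^{i(i-1)/2} φ(T_{v,i}) X^i`); over `ℂ` it is the accepted
`heckePolynomial` (Tamagawa; Shimura Thm. 3.21).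
[cite: HansenUniversalEigenvarieties2017, Def. 1.2.1] -/
def heckeFrobPoly (q n : ℕ) (t : ℕ → A) : A[X] :=
  ∑ i ∈ Finset.range (n + 1), Polynomial.C ((-1) ^ i * (q : A) ^ (i * (i - 1) / 2) * t i) *
    Polynomial.X ^ (n - i)

/-- Over `ℂ`, `heckeFrobPoly` is the accepted `heckePolynomial` (definitionally). [folklore] -/
theorem heckeFrobPoly_eq_heckePolynomial (q n : ℕ) (t : ℕ → ℂ) :
    heckeFrobPoly q n t = heckePolynomial q n t := rfl

/-- `heckeFrobPoly` commutes with ring homomorphisms (change of coefficients, e.g. along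
`ι : ℚ̄_p ≃+* ℂ`). [folklore] -/
theorem heckeFrobPoly_map (f : A →+* B) (q n : ℕ) (t : ℕ → A) :
    (heckeFrobPoly q n t).map f = heckeFrobPoly q n (f ∘ t) := by
  simp [heckeFrobPoly, Polynomial.map_sum, Polynomial.map_mul, Polynomial.map_pow]

/-- `heckeFrobPoly q n t` has degree at most `n`. [folklore] -/
theorem natDegree_heckeFrobPoly_le (q n : ℕ) (t : ℕ → A) :
    (heckeFrobPoly q n t).natDegree ≤ n := by
  unfold heckeFrobPoly
  refine Polynomial.natDegree_sum_le_of_forall_le _ _ fun i _ => ?_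
  exact (Polynomial.natDegree_C_mul_X_pow_le _ _).trans (Nat.sub_le n i)

/-- The coefficient of `X^n` in `heckeFrobPoly q n t` is `t 0` (the term `i = 0`). [folklore] -/
theorem coeff_heckeFrobPoly_self (q n : ℕ) (t : ℕ → A) :
    (heckeFrobPoly q n t).coeff n = t 0 := by
  unfold heckeFrobPoly
  rw [Polynomial.finsetSum_coeff, Finset.sum_eq_single_of_mem 0 (by simp)]
  · simp
  · intro i hi hi0
    rw [Polynomial.coeff_C_mul_X_pow]
    have : n ≠ n - i := by
      have := Finset.mem_range.mp hi
      omega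
    simp [this]

/-- With the normalisation `t 0 = 1` (`T_{v,0} = 1`), `heckeFrobPoly q n t` is monic of degree `n`,
as a characteristic polynomial of an `n × n` matrix must be. [folklore] -/
theorem monic_heckeFrobPoly (q n : ℕ) {t : ℕ → A} (ht : t 0 = 1) :
    (heckeFrobPoly q n t).Monic :=
  Polynomial.monic_of_natDegree_le_of_coeff_eq_one n (natDegree_heckeFrobPoly_le q n t)
    (by rw [coeff_heckeFrobPoly_self, ht])

end HeckeFrobPoly

/-! ### Hansen's "associated" relation (dot-notation extensions of the accepted `FramedGaloisRep`,
declared by absolute name from this file, CONVENTIONS §2) -/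

section Associated

variable {K : Type*} [Field K] [NumberField K] {A : Type*} [CommRing A] [TopologicalSpace A]
  {n : ℕ}

/-- **`ρ` and the Hecke eigenvalues `t` are associated at `v`** (Hansen, Definition 1.2.1): `ρ` is
unramified at `v` and the characteristic polynomial of a *geometric* Frobenius at `v` is
`∑_{i=0}^{n} (-1)^i q_v^{i(i-1)/2} t_i X^{n-i}` (`heckeFrobPoly`).  Hansen normalises `Frob_v`
geometrically (§1.4: uniformisers ↦ geometric Frobenii); the tree's Frobenii are arithmetic
(`IsArithFrobAt`, accepted `HasFrobCharpolyAt`), so the condition is imposed on `ρ(σ⁻¹)` for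
every arithmetic Frobenius `σ` at every prime `𝔓 ∣ v` of `\bar ℤ_K` (for `ρ` unramified at `v`
these `σ⁻¹` are exactly the geometric Frobenii and the polynomial does not depend on the
choices).  Intended use: `t i = φ_x(T_{v,i})`, `v ∉ S(K^p)`.  Dot-notation extension of the
accepted `GaloisRepresentations.FramedGaloisRep` (file `GaloisRepresentations/GaloisRep.lean`),
declared here by absolute name. [cite: HansenUniversalEigenvarieties2017, Def. 1.2.1] -/
def _root_.Literature.NumberTheory.GaloisRepresentations.FramedGaloisRep.IsHeckeAssociatedAt
    (ρ : GaloisRepresentations.FramedGaloisRep K A n) (v : HeightOneSpectrum (𝓞 K)) (t : ℕ → A) :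
    Prop :=
  ρ.IsUnramifiedAt v ∧
    ∀ 𝔓 ∈ v.primesAbove, ∀ σ : absoluteGaloisGroup K, IsArithFrobAt (𝓞 K) σ 𝔓 →
      GaloisRepresentations.FramedRep.charpoly ρ σ⁻¹ = heckeFrobPoly v.residueCard n t

/-- An associated `ρ` is unramified at `v` (first clause). [cite: HansenUniversalEigenvarieties2017, Def. 1.2.1] -/
theorem _root_.Literature.NumberTheory.GaloisRepresentations.FramedGaloisRep.IsHeckeAssociatedAt.isUnramifiedAt
    {ρ : GaloisRepresentations.FramedGaloisRep K A n} {v : HeightOneSpectrum (𝓞 K)} {t : ℕ → A}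
    (h : ρ.IsHeckeAssociatedAt v t) : ρ.IsUnramifiedAt v :=
  h.1

/-- An associated `ρ` has geometric-Frobenius characteristic polynomial `heckeFrobPoly q_v n t`
(second clause). [cite: HansenUniversalEigenvarieties2017, Def. 1.2.1] -/
theorem _root_.Literature.NumberTheory.GaloisRepresentations.FramedGaloisRep.IsHeckeAssociatedAt.charpoly_inv_eq
    {ρ : GaloisRepresentations.FramedGaloisRep K A n} {v : HeightOneSpectrum (𝓞 K)} {t : ℕ → A}
    (h : ρ.IsHeckeAssociatedAt v t) {𝔓 : Ideal (GaloisRepresentations.absIntegers (𝓞 K) K)}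
    (h𝔓 : 𝔓 ∈ v.primesAbove) {σ : absoluteGaloisGroup K} (hσ : IsArithFrobAt (𝓞 K) σ 𝔓) :
    GaloisRepresentations.FramedRep.charpoly ρ σ⁻¹ = heckeFrobPoly v.residueCard n t :=
  h.2 𝔓 h𝔓 σ hσ

/-- Association is functorial in the coefficients: unchanged statement, restated for `t` given
through a map (`heckeFrobPoly_map`), e.g. to compare with reductions. [folklore] -/
theorem _root_.Literature.NumberTheory.GaloisRepresentations.FramedGaloisRep.isHeckeAssociatedAt_iff
    (ρ : GaloisRepresentations.FramedGaloisRep K A n) (v : HeightOneSpectrum (𝓞 K)) (t : ℕ → A) :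
    ρ.IsHeckeAssociatedAt v t ↔ ρ.IsUnramifiedAt v ∧
      ∀ 𝔓 ∈ v.primesAbove, ∀ σ : absoluteGaloisGroup K, IsArithFrobAt (𝓞 K) σ 𝔓 →
        GaloisRepresentations.FramedRep.charpoly ρ σ⁻¹ = heckeFrobPoly v.residueCard n t :=
  Iff.rfl

end Associated

/-! ### Places above `p`, weights and torus characters -/

section Torus

variable (K : Type*) [Field K] [NumberField K] (n p : ℕ)

/-- The finite places of `K` above `p` (`v ∣ p`, i.e. `p ∈ v`). [folklore] -/
abbrev PlacesOver : Type _ :=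
  {v : HeightOneSpectrum (𝓞 K) // ((p : ℕ) : 𝓞 K) ∈ v.asIdeal}

variable (L : Type*) [Monoid L] [TopologicalSpace L]

/-- **`L`-valued `p`-adic weights** for `GL_n / K`: the `L`-points
`𝒲(L) = Hom_cts(T(ℤ_p), Lˣ)` of weight space, `T(ℤ_p) = ∏_{v ∣ p} (𝒪_{K_v}ˣ)^n` the integral
points of the diagonal torus of `∏_{v ∣ p} Res_{𝒪_{K_v}/ℤ_p} GL_n`, presented as an ordered
`n`-tuple, for each `v ∣ p`, of continuous characters `𝒪_{K_v}ˣ → Lˣ` (`λ = (λ_{v,1}, …, λ_{v,n})`).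
The level-`K^p` weight space `𝒲_{K^p} ⊂ 𝒲` is cut out by triviality on the closure of the global
units in `K^p I` (Hansen §2.2, p. 13); it is not imposed on the type.
[cite: HansenUniversalEigenvarieties2017, §1.1 and §2.2] [cite: McDonald2025, §1.2] -/
abbrev PAdicWeight : Type _ :=
  ∀ v : PlacesOver K p, Fin n → ((v.1.adicCompletionIntegers K)ˣ →ₜ* Lˣ)

/-- **`L`-valued characters of the `p`-adic torus** `T(ℚ_p) = ∏_{v ∣ p} (K_vˣ)^n`: the `L`-points
`T̂(L) = 𝒯(L) = Hom_cts(T(ℚ_p), Lˣ)`, presented as an ordered `n`-tuple, for each `v ∣ p`, of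
continuous characters `δ_{v,i} : K_vˣ → Lˣ` — the shape of the parameter of a triangulation of
`ρ|_{Gal_{K_v}}` (Hansen §1.2, "we identify any such character `δ` with an ordered `n`-tuple of
continuous characters"; McDonald §6).
[cite: HansenUniversalEigenvarieties2017, §1.2] [cite: McDonald2025, §1 and §6] -/
abbrev TorusCharacter : Type _ :=
  ∀ v : PlacesOver K p, Fin n → ((v.1.adicCompletion K)ˣ →ₜ* Lˣ)

variable {K n p L}

/-- The inclusion `𝒪_{K_v}ˣ → K_vˣ` as a continuous homomorphism. [folklore] -/
def integerUnitsToUnits (v : HeightOneSpectrum (𝓞 K)) :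
    (v.adicCompletionIntegers K)ˣ →ₜ* (v.adicCompletion K)ˣ where
  toMonoidHom := Units.map ((v.adicCompletionIntegers K).subtype : _ →+* v.adicCompletion K)
  continuous_toFun := Continuous.units_map _ continuous_subtype_val

/-- Unfolding lemma for `integerUnitsToUnits`: it is the inclusion on underlying elements. [folklore] -/
@[simp] theorem val_integerUnitsToUnits_apply (v : HeightOneSpectrum (𝓞 K))
    (u : (v.adicCompletionIntegers K)ˣ) :
    ((integerUnitsToUnits v u : (v.adicCompletion K)ˣ) : v.adicCompletion K) = (u : v.adicCompletionIntegers K) :=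
  rfl

/-- **The weight of a torus character**: restriction along `T(ℤ_p) ⊂ T(ℚ_p)`, i.e. of each
`δ_{v,i} : K_vˣ → Lˣ` to `𝒪_{K_v}ˣ`.  This is the map `T̂ → 𝒲` inducing the weight map
`κ : ℰ → 𝒲` of Fu–McDonald (McDonald §1.2: "the projection map `T̂ → 𝒲` induces a natural map
`κ`"). [cite: McDonald2025, §1.2] -/
def TorusCharacter.restrict (δ : TorusCharacter K n p L) : PAdicWeight K n p L :=
  fun v i => (δ v i).comp (integerUnitsToUnits v.1)

/-- Unfolding lemma for `TorusCharacter.restrict`. [folklore] -/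
@[simp] theorem TorusCharacter.restrict_apply (δ : TorusCharacter K n p L) (v : PlacesOver K p)
    (i : Fin n) (u : (v.1.adicCompletionIntegers K)ˣ) :
    δ.restrict v i u = δ v i (integerUnitsToUnits v.1 u) :=
  rfl

end Torus

/-! ### The eigenvariety datum -/

/-- An **eigenvariety datum for `GL_n / K` at `p` with bad places `S`** (`S = S(K^p) ⊇ {v ∣ p}`
for a tame level `K^p`): the arithmetic shadow of an eigenvariety `𝒳 = 𝒳_{Res_{K/ℚ} GL_n, K^p}`
(Hansen) / `ℰ^•(K^p)_𝔪` (Emerton–Fu–McDonald), namely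

* `Pt`: its `ℚ̄_p`-points, with the analytic Zariski topology `topology` (closed sets = points of
  Zariski-closed analytic subspaces; irreducible components and dimensions are read through
  Mathlib's `irreducibleComponents` / `topologicalKrullDim`);
* `heckeEigenvalue x v i = φ_x(T_{v,i}) ∈ ℚ̄_p`, the eigenvalue at `x` of the spherical Hecke
  operator of `diag(ϖ_v,…,ϖ_v,1,…,1)` (`i` entries `ϖ_v`) for `v ∉ S`, `1 ≤ i ≤ n` (Hansen §4.6),
  with the normalisation `T_{v,0} = 1` (`heckeEigenvalue_zero`); values at `v ∈ S` or `i > n` are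
  unused;
* `param x = δ_x ∈ T̂(ℚ̄_p)`, the parameter (Fu–McDonald: the second coordinate of the point
  `(x, δ)`; Hansen §1.2 (i)–(ii): `δ_x` built from `λ_x` and the `U_{v,i}`-eigenvalues), whose
  restriction to `T(ℤ_p)` is the weight `weight x` (Fu–McDonald convention);
* `galoisRep x = ρ_x : Gal_K → GL_n(ℚ̄_p)`, the (semisimple) Galois representation at `x`
  (Hansen Conj. 1.2.2; over CM / totally real `K` the specialisation of Scholze's determinant,
  McDonald Lemma 32) — a datum, meaningful where `HasGaloisFamily` holds;
* `degrees x`, the finite non-empty set of cohomological degrees in which the eigenpacket `φ_x`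
  occurs (`H^i(Y(K^pI), 𝒟_{λ_x})_{(ker φ_x)} ≠ 0`; for Fu's `ℰ^i` the fibres of `degrees`), so that
  Hansen's `l(x)` is `defect x = max − min` (§1.1, p. 7);
* `classical ⊆ Pt`, the classical points (Hansen Def. 3.2.3: `φ_x` occurs in the classical
  cohomology `H^*(Y(K^p I^s_1), ℒ_{λ^alg})`).

No theorem and no existence statement is a field: the properties proved for the two
constructions are the predicates `HasEigensystemInjective`, `HasGaloisFamily`,
`HasNewtonBound(With)`, `ClassicalPointsCuspidal`, `IsCongruentTo` below, and "there is such a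
datum with properties …" is a statement ABOUT this type (route NewtonPatching, crux
`EigenvarietyPackage`).  [cite: HansenUniversalEigenvarieties2017, Thm. 1.1.2, §1.2, Def. 4.2.1, Def. 4.3.2]
[cite: McDonald2025, §1 and §2.8] -/
structure Eigenvariety (K : Type) [Field K] [NumberField K] (n p : ℕ) [Fact p.Prime]
    (S : Set (HeightOneSpectrum (𝓞 K))) : Type 1 where
  /-- The `ℚ̄_p`-points `𝒳(ℚ̄_p)` of the eigenvariety. -/
  Pt : Type
  /-- The analytic Zariski topology on `𝒳(ℚ̄_p)`. -/
  topology : TopologicalSpace Pt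
  /-- `heckeEigenvalue x v i = φ_x(T_{v,i})`, the `T_{v,i}`-eigenvalue at `x` (`v ∉ S`, `1 ≤ i ≤ n`). -/
  heckeEigenvalue : Pt → HeightOneSpectrum (𝓞 K) → ℕ → PadicAlgCl p
  /-- Normalisation `T_{v,0} = [K_v 1 K_v] = 1`. -/
  heckeEigenvalue_zero : ∀ x v, heckeEigenvalue x v 0 = 1
  /-- The parameter `δ_x ∈ T̂(ℚ̄_p)` of the point `x`. -/
  param : Pt → TorusCharacter K n p (PadicAlgCl p)
  /-- The semisimple Galois representation `ρ_x : Gal_K → GL_n(ℚ̄_p)` at `x`. -/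
  galoisRep : Pt → GaloisRepresentations.FramedGaloisRep K (PadicAlgCl p) n
  /-- The cohomological degrees in which the eigenpacket of `x` occurs. -/
  degrees : Pt → Finset ℕ
  /-- An eigenpacket occurs in some degree. -/
  degrees_nonempty : ∀ x, (degrees x).Nonempty
  /-- The classical points. -/
  classical : Set Pt

namespace Eigenvariety

variable {K : Type} [Field K] [NumberField K] {n p : ℕ} [Fact p.Prime]
  {S : Set (HeightOneSpectrum (𝓞 K))}

/-- The analytic Zariski topology on the points of an eigenvariety datum (the structure field
`topology`, registered for instance search on the new type `E.Pt`; it overrides nothing). [folklore] -/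
instance instTopologicalSpacePt (E : Eigenvariety K n p S) : TopologicalSpace E.Pt := E.topology

/-- **The weight `λ_x = w(x) ∈ 𝒲(ℚ̄_p)`** of a point: the restriction of its parameter `δ_x` to
`T(ℤ_p)` (weight map `κ` of Fu–McDonald, McDonald §1.2; Hansen's `w : 𝒳 → 𝒲_{K^p}`, Thm. 1.1.2,
after his reindexing §1.2 (ii)). [cite: McDonald2025, §1.2] [cite: HansenUniversalEigenvarieties2017, Thm. 1.1.2] -/
def weight (E : Eigenvariety K n p S) (x : E.Pt) : PAdicWeight K n p (PadicAlgCl p) :=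
  (E.param x).restrict

/-- Unfolding lemma: the weight is the restriction of the parameter. [folklore] -/
theorem weight_apply (E : Eigenvariety K n p S) (x : E.Pt) (v : PlacesOver K p) (i : Fin n)
    (u : (v.1.adicCompletionIntegers K)ˣ) :
    E.weight x v i u = E.param x v i (integerUnitsToUnits v.1 u) :=
  rfl

/-- **Hansen's `l(x)`**: `sup − inf` of the degrees in which the eigenpacket of `x` occurs
(§1.1, p. 7: `l(x) = sup{i ∣ H^i(…)_{(ker φ_x)} ≠ 0} − inf{i ∣ …}`); interior non-critical regular
classical points have `l(x) = l(G) = rank G − rank K_∞` (loc. cit.), which for `Res_{K/ℚ} GL_n`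
is `r₁ ⌊(n-1)/2⌋ + r₂ (n-1)` (the tree's `Literature.Barriers.Langlands.defectGL r₁ r₂ n`).  The
`ℕ`-subtraction is exact (`min ≤ max`). [cite: HansenUniversalEigenvarieties2017, §1.1 (p. 7) and Thm. 1.1.6] -/
def defect (E : Eigenvariety K n p S) (x : E.Pt) : ℕ :=
  (E.degrees x).max' (E.degrees_nonempty x) - (E.degrees x).min' (E.degrees_nonempty x)

/-- A point whose eigenpacket occurs in a single degree has defect `0`. [folklore] -/
theorem defect_eq_zero_of_degrees_eq_singleton (E : Eigenvariety K n p S) (x : E.Pt) {i : ℕ}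
    (h : E.degrees x = {i}) : E.defect x = 0 := by
  unfold defect
  have hmax : (E.degrees x).max' (E.degrees_nonempty x) = i := by
    apply le_antisymm
    · exact Finset.max'_le _ _ _ fun j hj => by rw [h, Finset.mem_singleton] at hj; exact hj.le
    · exact Finset.le_max' _ _ (by rw [h]; exact Finset.mem_singleton_self i)
  have hmin : (E.degrees x).min' (E.degrees_nonempty x) = i := by
    apply le_antisymm
    · exact Finset.min'_le _ _ (by rw [h]; exact Finset.mem_singleton_self i)
    · exact Finset.le_min' _ _ _ fun j hj => by rw [h, Finset.mem_singleton] at hj; exact hj.ge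
  rw [hmax, hmin, Nat.sub_self]

/-- The Hecke–Frobenius polynomial `det(X − ρ_x(Frob_v))` predicted at `x` and `v ∉ S`
(`heckeFrobPoly q_v n (φ_x(T_{v,·}))`, Hansen Def. 1.2.1). [cite: HansenUniversalEigenvarieties2017, Def. 1.2.1] -/
def frobPoly (E : Eigenvariety K n p S) (x : E.Pt) (v : HeightOneSpectrum (𝓞 K)) :
    (PadicAlgCl p)[X] :=
  heckeFrobPoly v.residueCard n (E.heckeEigenvalue x v)

/-- `frobPoly` is monic of degree `n` (normalisation `T_{v,0} = 1`). [folklore] -/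
theorem monic_frobPoly (E : Eigenvariety K n p S) (x : E.Pt) (v : HeightOneSpectrum (𝓞 K)) :
    (E.frobPoly x v).Monic :=
  monic_heckeFrobPoly _ _ (E.heckeEigenvalue_zero x v)

/-! ### The properties -/

/-- **Injectivity of the eigensystem** (Hansen Thm. 1.1.2 (ii) = Thm. 4.3.3, the injectivity half:
a point is determined by its weight and its eigenpacket `φ_x : 𝐓(K^p) → ℚ̄_p`, i.e. by the
`T_{v,i}`-eigenvalues for `v ∉ S` together with `δ_x`, which records `λ_x` and the
`U_{v,i}`-eigenvalues; tautological for Fu–McDonald, whose points ARE pairs `(x, δ)`).  The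
surjectivity half ("every finite-slope eigenpacket of weight `λ` is a point over `λ`") is not
expressible without overconvergent cohomology. [cite: HansenUniversalEigenvarieties2017, Thm. 1.1.2 (ii) and Thm. 4.3.3]
[cite: McDonald2025, §2.8] -/
def HasEigensystemInjective (E : Eigenvariety K n p S) : Prop :=
  Function.Injective fun x : E.Pt =>
    (E.param x, fun (v : {v : HeightOneSpectrum (𝓞 K) // v ∉ S}) (i : Fin n) =>
      E.heckeEigenvalue x v.1 (i.1 + 1))

/-- **The Galois representations at the points** (Hansen Conj. 1.2.2 (i); a theorem when `K` is CM
or totally real: Scholze's determinant `Gal_K → 𝐓^S(K^p)_𝔪/I` specialised at `x`, McDonald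
Lemma 32, Scholze Thm. V.4.1 / Cor. V.4.4): every `ρ_x` is semisimple, and for every `v ∉ S` not
above `p` it is unramified at `v` and associated with the eigenpacket of `x` (Hansen Def. 1.2.1)
(`FramedGaloisRep.IsHeckeAssociatedAt`). [cite: HansenUniversalEigenvarieties2017, Def. 1.2.1 and Conj. 1.2.2 (i)]
[cite: McDonald2025, Lemma 32] [cite: Scholze2015, Thm. V.4.1 and Cor. V.4.4] -/
def HasGaloisFamily (E : Eigenvariety K n p S) : Prop :=
  ∀ x : E.Pt, (E.galoisRep x).toGaloisRep.IsSemisimple ∧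
    ∀ v : HeightOneSpectrum (𝓞 K), v ∉ S → ((p : ℕ) : 𝓞 K) ∉ v.asIdeal →
      (E.galoisRep x).IsHeckeAssociatedAt v (E.heckeEigenvalue x v)

/-- **Newton's lower bound with weight dimension `d`**: every irreducible component `C` of `𝒳`
containing `x` has (topological Krull) dimension `≥ d − l(x)`.  With `d = dim 𝒲_{K^p}` this is
Hansen–Newton, Thm. 1.1.6 (Appendix B); truncated subtraction is harmless (`d < l(x)` makes the
bound `0 ≤ dim C`). [cite: HansenUniversalEigenvarieties2017, Thm. 1.1.6] -/
def HasNewtonBoundWith (E : Eigenvariety K n p S) (d : ℕ) : Prop :=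
  ∀ (x : E.Pt) (C : Set E.Pt), C ∈ irreducibleComponents E.Pt → x ∈ C →
    ((d - E.defect x : ℕ) : WithBot ℕ∞) ≤ topologicalKrullDim C

/-- **Newton's lower bound** (Hansen–Newton Thm. 1.1.6) with the unconditional value
`d = n[K:ℚ] − rank 𝒪_Kˣ ≤ dim 𝒲_{K^p} = n[K:ℚ] − rank_{ℤ_p} \overline{E(K^p)}` (equality iff
Leopoldt's conjecture holds at `p`; the module docstring): every irreducible component through `x`
has dimension `≥ n[K:ℚ] − rank 𝒪_Kˣ − l(x)`.  This is the count used by route NewtonPatching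
(`Numerology`: over a CM field of degree `2d₀`, `n·2d₀ − (d₀−1) − d₀(n−1) = d₀ n + 1`).
[cite: HansenUniversalEigenvarieties2017, Thm. 1.1.6 and §2.2 (p. 13)] -/
def HasNewtonBound (E : Eigenvariety K n p S) : Prop :=
  E.HasNewtonBoundWith (n * Module.finrank ℚ K - NumberField.Units.rank K)

/-- Newton's bound is monotone in the weight dimension: a bound with `d` gives the bound with any
`d' ≤ d`. [folklore] -/
theorem HasNewtonBoundWith.mono {E : Eigenvariety K n p S} {d d' : ℕ} (h : E.HasNewtonBoundWith d)
    (hd : d' ≤ d) : E.HasNewtonBoundWith d' := by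
  intro x C hC hx
  refine le_trans ?_ (h x C hC hx)
  exact_mod_cast Nat.sub_le_sub_right hd _

/-- **`x` matches the cuspidal automorphic representation `π`** (through `ι : ℚ̄_p ≃+* ℂ`): `π` is
regular algebraic (as cuspidal cohomological representations are: Hansen Prop. 3.2.1 with Clozel,
Ann Arbor 1990, Lemme 3.14) and at every `v ∉ S` the Hecke polynomial of `π`
(accepted `AutomorphicRepData.HasHeckePolynomialAt`: `∏_j (X − q_v^{(n-1)/2} α_j)` for the Satake
parameter `α`, equal by Tamagawa's identity to `∑ (-1)^i q_v^{i(i-1)/2} t_{v,i} X^{n-i}` for the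
`T_{v,i}`-eigenvalues `t_{v,i}` of the spherical vector) is `ι` of the Hecke–Frobenius polynomial of
`x` — i.e. `φ_x` "matches the Hecke data of `π`" away from `S` (Hansen §1.1, definition of classical
points).  The refinement of `π_v`, `v ∣ p`, singled out by `δ_x` is not recorded (no local
components `π_v` in the tree). [cite: HansenUniversalEigenvarieties2017, §1.1 (classical points), Prop. 3.2.1, Def. 3.2.3] -/
def MatchesCuspidal (E : Eigenvariety K n p S) {hcpt : isCompact_glFiniteIntegralLevel n K}
    (ι : PadicAlgCl p ≃+* ℂ) (x : E.Pt) (π : CuspidalAutomorphicRepData n K hcpt) : Prop :=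
  π.1.IsRegularAlgebraic ∧
    ∀ v : HeightOneSpectrum (𝓞 K), v ∉ S →
      π.1.HasHeckePolynomialAt v ((E.frobPoly x v).map ι.toRingHom)

/-- **Classical points are cuspidal automorphic**: every classical point matches some cuspidal
automorphic representation of `GL_n(𝔸_K)` (`MatchesCuspidal`).  For the eigenvariety localised at
a non-Eisenstein `𝔪` (absolutely irreducible `ρ̄`) classical eigenpackets are cuspidal (interior);
in general Hansen's classical points also see Eisenstein classes, so this is a property of the
datum, not a tautology. `∀ hcpt` threading as in the accepted `AutomorphicRepsGL` (D-0014).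
[cite: HansenUniversalEigenvarieties2017, Prop. 3.2.1 and Def. 3.2.3] [cite: McDonald2025, Def. 63 and Cor. 64] -/
def ClassicalPointsCuspidal (E : Eigenvariety K n p S) (hcpt : isCompact_glFiniteIntegralLevel n K)
    (ι : PadicAlgCl p ≃+* ℂ) : Prop :=
  ∀ x ∈ E.classical, ∃ π : CuspidalAutomorphicRepData n K hcpt, E.MatchesCuspidal ι x π

/-- **`x` is congruent to `ρ̄`** (the point lies on the `ρ̄`-part `𝒳(ρ̄)`, i.e. its eigenpacket
factors through the localisation at the maximal ideal `𝔪 = 𝔪_ρ̄`): at every `v ∉ S` not above `p`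
the Hecke eigenvalues `φ_x(T_{v,i})` are `p`-integral, with reductions `t̄_{v,i}` through
`θ : \bar ℤ_p → k`, and `ρ̄` is associated with `t̄` at `v` in the sense of Hansen Def. 1.2.1
(`IsHeckeAssociatedAt`, same geometric-Frobenius convention on both sides): `ρ̄` unramified at `v`
and `det(X − ρ̄(Frob_v)) = ∑ (-1)^i q_v^{i(i-1)/2} t̄_{v,i} X^{n-i}`.  This is how `ρ̄_𝔪` is
characterised (McDonald §2.8: "the characteristic polynomial of `ρ̄_𝔪(Frob_ν)` is equal to
`P_ν(X) mod 𝔪`"; Scholze Cor. V.4.3). [cite: McDonald2025, §2.8] [cite: Scholze2015, Cor. V.4.3] -/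
def IsCongruentTo (E : Eigenvariety K n p S) {k : Type*} [Field k] [TopologicalSpace k]
    (θ : (Valued.v : Valuation (PadicAlgCl p) NNReal).valuationSubring →+* k)
    (ρb : GaloisRepresentations.FramedGaloisRep K k n) (x : E.Pt) : Prop :=
  ∀ v : HeightOneSpectrum (𝓞 K), v ∉ S → ((p : ℕ) : 𝓞 K) ∉ v.asIdeal →
    ∃ t : ℕ → (Valued.v : Valuation (PadicAlgCl p) NNReal).valuationSubring,
      (∀ i, ((t i : (Valued.v : Valuation (PadicAlgCl p) NNReal).valuationSubring) : PadicAlgCl p) =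
          E.heckeEigenvalue x v i) ∧
        ρb.IsHeckeAssociatedAt v (θ ∘ t)

/-! ### Restriction to a set of points -/

/-- **Restriction of an eigenvariety datum to a set of points `Y`** (Hansen's tautology after
Thm. 4.2.2: a Zariski-closed `𝒴 ↪ 𝒳` is the eigenvariety of the datum
`𝔇_𝒴 = (𝒲, 𝒵, π_*(ℳ^† ⊗ 𝒪_𝒳/ℐ_𝒴), 𝐓, φ_𝒳 mod ℐ_𝒴)`; used for the `ρ̄`-part `𝒳(ρ̄)`, unions of
irreducible components, the cuspidal locus …): points `Y` with the subspace topology and all data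
restricted. [cite: HansenUniversalEigenvarieties2017, §4.2 (after Thm. 4.2.2)] -/
def restrict (E : Eigenvariety K n p S) (Y : Set E.Pt) : Eigenvariety K n p S where
  Pt := Y
  topology := inferInstance
  heckeEigenvalue x := E.heckeEigenvalue x.1
  heckeEigenvalue_zero x := E.heckeEigenvalue_zero x.1
  param x := E.param x.1
  galoisRep x := E.galoisRep x.1
  degrees x := E.degrees x.1
  degrees_nonempty x := E.degrees_nonempty x.1
  classical := Subtype.val ⁻¹' E.classical

/-- Points of the restriction are points of `Y`. [folklore] -/
@[simp] theorem restrict_Pt (E : Eigenvariety K n p S) (Y : Set E.Pt) : (E.restrict Y).Pt = Y := rfl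

/-- The Hecke–Frobenius polynomials of the restriction are those of `E`. [folklore] -/
@[simp] theorem frobPoly_restrict (E : Eigenvariety K n p S) (Y : Set E.Pt) (x : Y)
    (v : HeightOneSpectrum (𝓞 K)) : (E.restrict Y).frobPoly x v = E.frobPoly x.1 v := rfl

/-- The defect of a point of the restriction is its defect in `E`. [folklore] -/
@[simp] theorem defect_restrict (E : Eigenvariety K n p S) (Y : Set E.Pt) (x : Y) :
    (E.restrict Y).defect x = E.defect x.1 := rfl

/-- Restriction preserves injectivity of the eigensystem. [folklore] -/
theorem HasEigensystemInjective.restrict {E : Eigenvariety K n p S} (h : E.HasEigensystemInjective)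
    (Y : Set E.Pt) : (E.restrict Y).HasEigensystemInjective :=
  fun _ _ hxy => Subtype.ext (h hxy)

/-- Restriction preserves the Galois family property (it is pointwise). [folklore] -/
theorem HasGaloisFamily.restrict {E : Eigenvariety K n p S} (h : E.HasGaloisFamily) (Y : Set E.Pt) :
    (E.restrict Y).HasGaloisFamily :=
  fun x => h x.1

/-- Restriction preserves "classical points are cuspidal" (it is pointwise). [folklore] -/
theorem ClassicalPointsCuspidal.restrict {E : Eigenvariety K n p S}
    {hcpt : isCompact_glFiniteIntegralLevel n K} {ι : PadicAlgCl p ≃+* ℂ}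
    (h : E.ClassicalPointsCuspidal hcpt ι) (Y : Set E.Pt) :
    (E.restrict Y).ClassicalPointsCuspidal hcpt ι := by
  intro x hx
  obtain ⟨π, hπ⟩ := h x.1 hx
  exact ⟨π, hπ⟩

/-- **The `ρ̄`-part `𝒳(ρ̄)`** of an eigenvariety datum: restriction to the points congruent to `ρ̄`
(`IsCongruentTo`), i.e. localisation at the maximal ideal `𝔪_ρ̄` (McDonald §2.8, `ℰ^i(K^p)_𝔪`).
[cite: McDonald2025, §2.8] -/
def rhoBarPart (E : Eigenvariety K n p S) {k : Type*} [Field k] [TopologicalSpace k]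
    (θ : (Valued.v : Valuation (PadicAlgCl p) NNReal).valuationSubring →+* k)
    (ρb : GaloisRepresentations.FramedGaloisRep K k n) : Eigenvariety K n p S :=
  E.restrict {x | E.IsCongruentTo θ ρb x}

/-- Every point of the `ρ̄`-part is congruent to `ρ̄` (by construction). [folklore] -/
theorem isCongruentTo_rhoBarPart (E : Eigenvariety K n p S) {k : Type*} [Field k]
    [TopologicalSpace k] (θ : (Valued.v : Valuation (PadicAlgCl p) NNReal).valuationSubring →+* k)
    (ρb : GaloisRepresentations.FramedGaloisRep K k n) (x : (E.rhoBarPart θ ρb).Pt) :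
    (E.rhoBarPart θ ρb).IsCongruentTo θ ρb x :=
  x.2

end Eigenvariety

end Literature.NumberTheory.Automorphic

end
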